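/-
Copyright (c) 2026 the pub-hodgecm-mathlib formalisation cell (harness21).  Prover seat hodgecm-mathlib-R90-C133-p02 (g2), Track B ∕ R90-TF, h413 = `stmt-HodgeConjecture-24833`,
R90-TF section S8 «ContSpec-n½» (S8 dealer R90-CS-plan (g3) S8-R186 «(β)»; census `R90/S8/CENSUS-ADM-payer.R90-C133-p02-g2.md` 1918f47b2978fa74 item 3 + the (W1′) refinement
2026-09-05T01:3xZ): step (β′) of the (ADM) payer road of ★ p863816 — THE MIDDLE-POLE RESIDUE RELATION AT THE TRIVIAL LEVEL as a linear graph `Gr ≤ (G(𝔸) → ℂ) × L²` (★ p863302's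
construction at `(K′, ω) := (⊥, 1)`, exported), its vertical-line test (uniqueness ★ p863205), its `K_max`-TRANSPORT `(φ, f) ↦ (r(k)φ, R(k)f)`, and the generators of the level-free atom
as its second projection.
-/
import Summits.HodgeConjecture.HodgeConjecture.Theorems.R90S8ResGMidAtomFiniteDimensionalU3    -- ★ p863302 (R90-C133-p02 (g0)): `midResidueFun_eq_of_clauses`; brings ★ p863205 `midPoleLetter_apply_quotientSubgroup_mul`, `flatSectionU_rightTranslation`, ★ p862921 `rightTranslation_mem_chiSectionSpacePair`, `eisensteinSeriesU_rightTranslation`, ★ p862682 D1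
import Summits.HodgeConjecture.HodgeConjecture.Theorems.R90S8ResGMidBlockDiscreteOfKTypesU3     -- ★ p863816 (this seat): `resGMidAtomGen_subset_resGMidAtomGen_bot` (level antitone), the (INV)+(ADM) reduction this road pays into
import Literature.NumberTheory.Automorphic.UnitaryGroupCuspIntegralSiegelMajorant           -- ★ `borelHeight_mul_of_mem_comap_standardMaximalCompactGL`
import HarnessLib

/-!
# S8 (R)′ road, letter (ADM) step (β′) — `R90S8ResGMidResidueGraphBotU3`: THE MIDDLE-POLE RESIDUE RELATION «`f` is a.e. the residue at `3/2` of the continued Eisenstein family of the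
# continuous level-free pair-section `φ`» IS A LINEAR GRAPH, SINGLE-VALUED IN `φ`, `K_max`-EQUIVARIANT, whose second projection is the generator set of the level-free atom

Track B ∕ R90-TF, crux h413 = `stmt-HodgeConjecture-24833`, route of record `HCCMUnconditional`; cell `hodgecm-mathlib`, R90-TF section S8 «ContSpec-n½ ∕ ResidualSpectrum», socket (R)
(B ED. 7 :337) ← ★ `res_midBlock_le_residual_of_letters' (hDISC) …` ← ★ p863816 `hDISC_of_inv_of_admissible (hINV) (hADM)` ← (ADM) payer road {(α) ★-to-be `R90S8TauPartFiniteOfGeneratorsU3`,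
(β′) THIS FILE, (γ) ★ p863857, (W1′) letter}.  THEOREMS ONLY (no `def`, no `instance`, no `notation`, no named-fact hypothesis, no `sorry`; default heartbeats); lane
`--supports stmt-HodgeConjecture-24833 --as helper` (count-neutral).  CLOSES NO SOCKET.  One visible letter: ★ p863302's `hsum` (absolute convergence of `E(flatSectionU φ z)` on
`2 < Re z` for the block's continuous sections; ★ `summable_eisensteinSeriesU_flatSectionU_cm_three` for bounded `φ`), at level `(⊥, 1)`.

THE MATHEMATICS ([MoeglinWaldspurger1995] I.2.17, II.1.5, IV.1.11, V.3.13; [Rogawski1990] §13.9 p. 229 (ii)).  `REL(φ, f)`: `φ ∈ V := V(ξ.bcη⁻¹·ξ.bcψ⁻¹·μω, ξ.ψ; ⊥, 1)` continuous,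
and for SOME continuation data `(Ec, Sp, Fp)` of ★ D1 the class `f ∈ L²` is a.e. `x ↦ Fp((out x)⁻¹)(3/2)`.  §1: `REL` is the carrier of a SUBMODULE `Gr ≤ (G(𝔸) → ℂ) × L²` (data add —
`hsum` — and scale; ★ p863302's graph, here EXPORTED as `∃ Gr, ∀ p, p ∈ Gr ↔ REL p` — no `def`).  §2: the first projection is injective on `Gr` (★ `midResidueFun_eq_of_clauses`: the residue
FUNCTION is determined by `φ`), so `Gr` passes the vertical-line test and Mathlib's `Submodule.toLinearPMap Gr` is THE (partial) residue map `Res : dom → L²`, `dom = Gr.map fst`.  §3: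
`K_max`-TRANSPORT — `REL(φ, f) ⇒ REL(r(k)φ, R(k)f)` for `k ∈ K_max` with the data `(Ec(·)(·k), Sp, Fp(·k))` (★ p863205 §3's proof, whose statement hides the section; `K_max` preserves the
Borel height ★, and commutes with `⊥`); hence `dom` is `K_max`-stable and `Res` is `K_max`-equivariant (§2 uniqueness).  §4: `f ∈ resGMidAtomGen ξ μω ⊥ 1 ↔ ∃ φ, REL(φ, f)`, so the
generators of the level-free atom are `Gr.map snd`.
* §1 **`exists_midResidueGraph_bot (hsum)`**.  * §2 `midResidueGraph_snd_eq_of_fst_eq`, `midResidueGraph_snd_eq_zero_of_fst_eq_zero` (vertical line), **`mem_midResidueGraph_toLinearPMap`**.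
* §3 **`rightTranslation_mem_midResidueGraph`** (`k ∈ K_max`), `rightTranslation_mem_map_fst_midResidueGraph` (the domain is `K_max`-stable), **`toLinearPMap_rightTranslation`** (`Res` is
  `K_max`-equivariant).  * §4 **`mem_resGMidAtomGen_bot_iff_exists_mem_midResidueGraph`**, `resGMidAtomGen_bot_subset_map_snd`.
HONEST LABEL: HC_CM is proved only modulo the 7 printed citations (2 remaining named inputs: hLiu418 = `stmt-HodgeConjecture-24832`, h413 = `stmt-HodgeConjecture-24833`) until
rung 0 closes; REL ≠ ★ ≠ BUILT; step (β′) modulo `hsum`; (INV)∕(W1′) OPEN letters; asserts no named fact and closes no socket; count-neutral.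

## References
* [MoeglinWaldspurger1995] C. Mœglin, J.-L. Waldspurger, *Spectral Decomposition and Eisenstein Series* (1995), I.2.17, II.1.5, IV.1.11, V.3.13.
* [Rogawski1990] J. D. Rogawski, *Automorphic Representations of Unitary Groups in Three Variables* (1990), §13.9 p. 229 (ii).
* [BorelJacquet1979] A. Borel, H. Jacquet, *Automorphic forms and automorphic representations*, Corvallis PSPM 33.1 (1979), §4.6.
-/

set_option autoImplicit false
set_option linter.dupNamespace false  -- the mandated namespace `…HodgeConjecture.HodgeConjecture.R90.S8` (LEAD #1 L1) repeats the summit's segment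

noncomputable section

open MeasureTheory Measure Set Filter Topology NumberField ContRepresentation
open Literature.NumberTheory Literature.NumberTheory.Automorphic Literature.NumberTheory.Automorphic.UnitaryGroup Literature.NumberTheory.GaloisRepresentations AdelicGroupData
open Literature.NumberTheory.Automorphic.Arthur2013.Leaves.TECR Literature.NumberTheory.Rogawski1990
open Summit.HodgeConjecture.HodgeConjecture.Cruxes.H413.K2E1BorelEisensteinU
open Summit.HodgeConjecture.HodgeConjecture.Cruxes.H413.K2E1CharacterEisensteinU3PairDefs
open Summit.HodgeConjecture.HodgeConjecture.Cruxes.H413.K2E1ChiSectionSpaceU3PairDefs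
open scoped ENNReal NNReal

namespace Summit.HodgeConjecture.HodgeConjecture.R90.S8

variable (L : Type) [Field L] [NumberField L] [IsCMField L]
  (μ : Measure (quasiSplit (↥(maximalRealSubfield L)) L (IsCMField.complexConj L) 3).automorphicQuotient)
  (ξ : OneDimAutRepH L) (μω : HeckeCharacter L)

/-! ## §1 The residue relation at the trivial level is a linear graph -/

/-- **THE MIDDLE-POLE RESIDUE RELATION AT LEVEL `(⊥, 1)` IS THE CARRIER OF A SUBMODULE `Gr ≤ (G(𝔸) → ℂ) × L²`** (★ p863302's graph, exported): `p ∈ Gr` iff `p.1` is a continuous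
level-free pair-section of the `φ_ξ`-block and `p.2` is a.e. the value at `3/2` of a pole letter of SOME inline continuation of `E(flatSectionU p.1 ·)` (the clauses of ★ D1
`resGMidAtomGen … ⊥ 1`, section exposed).  Additivity of data needs the visible letter `hsum` (Godement summability on `2 < Re z`; ★ `summable_eisensteinSeriesU_flatSectionU_cm_three` for
bounded sections). [cite: MoeglinWaldspurger1995, I.2.17, IV.1.11] [cite: Rogawski1990, §13.9 p. 229 (ii)] -/
theorem exists_midResidueGraph_bot
    (hsum : ∀ φ ∈ chiSectionSpacePair (ξ.bcη⁻¹ * ξ.bcψ⁻¹ * μω) ξ.ψ (⊥ : Subgroup (quasiSplit (↥(maximalRealSubfield L)) L (IsCMField.complexConj L) 3).Adelic)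
        ((1 : ↥(⊥ : Subgroup (quasiSplit (↥(maximalRealSubfield L)) L (IsCMField.complexConj L) 3).Adelic) →* ℂ) : ↥(⊥ : Subgroup (quasiSplit (↥(maximalRealSubfield L)) L (IsCMField.complexConj L) 3).Adelic) → ℂ),
      Continuous φ → ∀ z : ℂ, 2 < z.re → ∀ g : (quasiSplit (↥(maximalRealSubfield L)) L (IsCMField.complexConj L) 3).Adelic,
      Summable fun q : Quotient (MulAction.orbitRel ↥(borelU ((IsCMField.complexConj L : L ≃ₐ[↥(maximalRealSubfield L)] L) : L →+* L) ((StdForm.antidiagonal 3).over L)) ↥(unitaryGroupOfForm ((IsCMField.complexConj L : L ≃ₐ[↥(maximalRealSubfield L)] L) : L →+* L) ((StdForm.antidiagonal 3).over L))) =>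
        ‖flatSectionU φ z ((quasiSplit (↥(maximalRealSubfield L)) L (IsCMField.complexConj L) 3).toAdelic (Quotient.out q : ↥(unitaryGroupOfForm ((IsCMField.complexConj L : L ≃ₐ[↥(maximalRealSubfield L)] L) : L →+* L) ((StdForm.antidiagonal 3).over L))) * g)‖) :
    ∃ Gr : Submodule ℂ (((quasiSplit (↥(maximalRealSubfield L)) L (IsCMField.complexConj L) 3).Adelic → ℂ) × (quasiSplit (↥(maximalRealSubfield L)) L (IsCMField.complexConj L) 3).L2 μ),
      ∀ p, p ∈ Gr ↔ (p.1 ∈ chiSectionSpacePair (ξ.bcη⁻¹ * ξ.bcψ⁻¹ * μω) ξ.ψ (⊥ : Subgroup (quasiSplit (↥(maximalRealSubfield L)) L (IsCMField.complexConj L) 3).Adelic)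
          ((1 : ↥(⊥ : Subgroup (quasiSplit (↥(maximalRealSubfield L)) L (IsCMField.complexConj L) 3).Adelic) →* ℂ) : ↥(⊥ : Subgroup (quasiSplit (↥(maximalRealSubfield L)) L (IsCMField.complexConj L) 3).Adelic) → ℂ) ∧ Continuous p.1 ∧
        ∃ (Ec : ℂ → (quasiSplit (↥(maximalRealSubfield L)) L (IsCMField.complexConj L) 3).Adelic → ℂ) (Sp : Finset ℂ)
          (_ : ∀ s ∈ Sp, s.im = 0 ∧ 1 < s.re ∧ s.re ≤ 2)
          (_ : ∀ g, DifferentiableOn ℂ (fun z => Ec z g) ({z : ℂ | 1 < z.re} \ (↑Sp : Set ℂ)))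
          (_ : ∀ z : ℂ, 2 < z.re → Ec z = eisensteinSeriesU (flatSectionU p.1 z))
          (Fp : (quasiSplit (↥(maximalRealSubfield L)) L (IsCMField.complexConj L) 3).Adelic → ℂ → ℂ)
          (_ : ∀ g, AnalyticAt ℂ (Fp g) ((3 : ℂ) / 2))
          (_ : ∀ g, Fp g =ᶠ[𝓝[≠] ((3 : ℂ) / 2)] fun z => (z - (3 : ℂ) / 2) * Ec z g),
          (p.2 : (quasiSplit (↥(maximalRealSubfield L)) L (IsCMField.complexConj L) 3).automorphicQuotient → ℂ) =ᵐ[μ] (fun x : (quasiSplit (↥(maximalRealSubfield L)) L (IsCMField.complexConj L) 3).automorphicQuotient => Fp (Quotient.out (x : ((quasiSplit (↥(maximalRealSubfield L)) L (IsCMField.complexConj L) 3).Adelic ⧸ (quasiSplit (↥(maximalRealSubfield L)) L (IsCMField.complexConj L) 3).quotientSubgroup)))⁻¹ ((3 : ℂ) / 2))) := by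
  -- adapted from ★ p863302 `finiteDimensional_resGMidAtom_of_letters` (the `set Gr` block), at `(K′, ω) := (⊥, 1)`
  refine ⟨
    { carrier := {p | p.1 ∈ chiSectionSpacePair (ξ.bcη⁻¹ * ξ.bcψ⁻¹ * μω) ξ.ψ (⊥ : Subgroup (quasiSplit (↥(maximalRealSubfield L)) L (IsCMField.complexConj L) 3).Adelic)
          ((1 : ↥(⊥ : Subgroup (quasiSplit (↥(maximalRealSubfield L)) L (IsCMField.complexConj L) 3).Adelic) →* ℂ) : ↥(⊥ : Subgroup (quasiSplit (↥(maximalRealSubfield L)) L (IsCMField.complexConj L) 3).Adelic) → ℂ) ∧ Continuous p.1 ∧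
        ∃ (Ec : ℂ → (quasiSplit (↥(maximalRealSubfield L)) L (IsCMField.complexConj L) 3).Adelic → ℂ) (Sp : Finset ℂ)
          (_ : ∀ s ∈ Sp, s.im = 0 ∧ 1 < s.re ∧ s.re ≤ 2)
          (_ : ∀ g, DifferentiableOn ℂ (fun z => Ec z g) ({z : ℂ | 1 < z.re} \ (↑Sp : Set ℂ)))
          (_ : ∀ z : ℂ, 2 < z.re → Ec z = eisensteinSeriesU (flatSectionU p.1 z))
          (Fp : (quasiSplit (↥(maximalRealSubfield L)) L (IsCMField.complexConj L) 3).Adelic → ℂ → ℂ)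
          (_ : ∀ g, AnalyticAt ℂ (Fp g) ((3 : ℂ) / 2))
          (_ : ∀ g, Fp g =ᶠ[𝓝[≠] ((3 : ℂ) / 2)] fun z => (z - (3 : ℂ) / 2) * Ec z g),
          (p.2 : (quasiSplit (↥(maximalRealSubfield L)) L (IsCMField.complexConj L) 3).automorphicQuotient → ℂ) =ᵐ[μ] (fun x : (quasiSplit (↥(maximalRealSubfield L)) L (IsCMField.complexConj L) 3).automorphicQuotient => Fp (Quotient.out (x : ((quasiSplit (↥(maximalRealSubfield L)) L (IsCMField.complexConj L) 3).Adelic ⧸ (quasiSplit (↥(maximalRealSubfield L)) L (IsCMField.complexConj L) 3).quotientSubgroup)))⁻¹ ((3 : ℂ) / 2))}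
      add_mem' := ?_, zero_mem' := ?_, smul_mem' := ?_ }, fun p => Iff.rfl⟩
  · rintro ⟨φ₁, f₁⟩ ⟨φ₂, f₂⟩ ⟨hφ₁, hc₁, Ec₁, Sp₁, hSp₁, hol₁, hEc₁, Fp₁, hF₁, hFE₁, hae₁⟩ ⟨hφ₂, hc₂, Ec₂, Sp₂, hSp₂, hol₂, hEc₂, Fp₂, hF₂, hFE₂, hae₂⟩
    simp only at hφ₁ hc₁ hEc₁ hae₁ hφ₂ hc₂ hEc₂ hae₂
    refine ⟨Submodule.add_mem _ hφ₁ hφ₂, hc₁.add hc₂, fun z g => Ec₁ z g + Ec₂ z g, Sp₁ ∪ Sp₂, fun t ht => ?_, fun g => ?_, fun z hz => ?_,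
      fun g z => Fp₁ g z + Fp₂ g z, fun g => (hF₁ g).add (hF₂ g), fun g => ?_, ?_⟩
    · rcases Finset.mem_union.1 ht with h | h
      · exact hSp₁ t h
      · exact hSp₂ t h
    · have h1 := (hol₁ g).mono (Set.sdiff_subset_sdiff_right (Finset.coe_subset.2 Finset.subset_union_left) : ({z : ℂ | 1 < z.re} \ (↑(Sp₁ ∪ Sp₂) : Set ℂ)) ⊆ {z : ℂ | 1 < z.re} \ (↑Sp₁ : Set ℂ))
      have h2 := (hol₂ g).mono (Set.sdiff_subset_sdiff_right (Finset.coe_subset.2 Finset.subset_union_right) : ({z : ℂ | 1 < z.re} \ (↑(Sp₁ ∪ Sp₂) : Set ℂ)) ⊆ {z : ℂ | 1 < z.re} \ (↑Sp₂ : Set ℂ))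
      exact h1.add h2
    · funext g
      have hflat : flatSectionU (φ₁ + φ₂) z = flatSectionU φ₁ z + flatSectionU φ₂ z := by
        funext y
        simp only [flatSectionU_apply, Pi.add_apply, add_mul]
      show Ec₁ z g + Ec₂ z g = eisensteinSeriesU (flatSectionU (φ₁ + φ₂) z) g
      rw [hflat, eisensteinSeriesU_add ((hsum φ₁ hφ₁ hc₁ z hz g).of_norm) ((hsum φ₂ hφ₂ hc₂ z hz g).of_norm), hEc₁ z hz, hEc₂ z hz]
    · filter_upwards [hFE₁ g, hFE₂ g] with w h1 h2
      rw [h1, h2, mul_add]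
    · filter_upwards [hae₁, hae₂, Lp.coeFn_add f₁ f₂] with x h1 h2 h12
      show ((f₁ + f₂ : (quasiSplit (↥(maximalRealSubfield L)) L (IsCMField.complexConj L) 3).L2 μ) : (quasiSplit (↥(maximalRealSubfield L)) L (IsCMField.complexConj L) 3).automorphicQuotient → ℂ) x = _
      rw [h12, Pi.add_apply, h1, h2]
  · refine ⟨Submodule.zero_mem _, continuous_const, fun _ _ => 0, ∅, fun t ht => (Finset.notMem_empty t ht).elim, fun g => ?_, fun z hz => ?_,
      fun _ _ => 0, fun g => analyticAt_const, fun g => Eventually.of_forall fun w => by simp, ?_⟩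
    · exact differentiableOn_const 0
    · funext g
      have hflat : flatSectionU (0 : (quasiSplit (↥(maximalRealSubfield L)) L (IsCMField.complexConj L) 3).Adelic → ℂ) z = 0 := by
        funext y
        simp only [flatSectionU_apply, Pi.zero_apply, zero_mul]
      show (0 : ℂ) = eisensteinSeriesU (flatSectionU (0 : (quasiSplit (↥(maximalRealSubfield L)) L (IsCMField.complexConj L) 3).Adelic → ℂ) z) g
      rw [hflat]
      simp only [eisensteinSeriesU, Pi.zero_apply, tsum_zero]
    · filter_upwards [Lp.coeFn_zero (E := ℂ) (p := 2) (μ := μ)] with x hx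
      show ((0 : (quasiSplit (↥(maximalRealSubfield L)) L (IsCMField.complexConj L) 3).L2 μ) : (quasiSplit (↥(maximalRealSubfield L)) L (IsCMField.complexConj L) 3).automorphicQuotient → ℂ) x = _
      rw [hx, Pi.zero_apply]
  · rintro a ⟨φ, f⟩ ⟨hφ, hc, Ec, Sp, hSp, hol, hEc, Fp, hF, hFE, hae⟩
    simp only at hφ hc hEc hae
    refine ⟨Submodule.smul_mem _ a hφ, hc.const_smul a, fun z g => a * Ec z g, Sp, hSp, fun g => (hol g).const_mul a, fun z hz => ?_,
      fun g z => a * Fp g z, fun g => analyticAt_const.mul (hF g), fun g => ?_, ?_⟩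
    · funext g
      have hflat : flatSectionU (a • φ) z = a • flatSectionU φ z := by
        funext y
        simp only [flatSectionU_apply, Pi.smul_apply, smul_eq_mul, mul_assoc]
      show a * Ec z g = eisensteinSeriesU (flatSectionU (a • φ) z) g
      rw [hflat, eisensteinSeriesU_smul, hEc z hz]
    · filter_upwards [hFE g] with w h
      show a * Fp g w = (w - (3 : ℂ) / 2) * (a * Ec w g)
      rw [h]
      ring
    · filter_upwards [hae, Lp.coeFn_smul a f] with x h hs
      show ((a • f : (quasiSplit (↥(maximalRealSubfield L)) L (IsCMField.complexConj L) 3).L2 μ) : (quasiSplit (↥(maximalRealSubfield L)) L (IsCMField.complexConj L) 3).automorphicQuotient → ℂ) x = _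
      rw [hs, Pi.smul_apply, h, smul_eq_mul]

/-! ## §2 The vertical-line test: the residue class is a function of the section; `Res := Gr.toLinearPMap` -/

/-- **The first projection is injective on `Gr`**: two pairs with the same section have the same class (★ `midResidueFun_eq_of_clauses` — uniqueness of the continuation and of the pole
letter's value at `3/2` given `φ` — then `Lp.ext`). [cite: MoeglinWaldspurger1995, IV.1.11] -/
theorem midResidueGraph_snd_eq_of_fst_eq (Gr : Submodule ℂ (((quasiSplit (↥(maximalRealSubfield L)) L (IsCMField.complexConj L) 3).Adelic → ℂ) × (quasiSplit (↥(maximalRealSubfield L)) L (IsCMField.complexConj L) 3).L2 μ))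
    (hGr : ∀ p, p ∈ Gr ↔ (p.1 ∈ chiSectionSpacePair (ξ.bcη⁻¹ * ξ.bcψ⁻¹ * μω) ξ.ψ (⊥ : Subgroup (quasiSplit (↥(maximalRealSubfield L)) L (IsCMField.complexConj L) 3).Adelic)
          ((1 : ↥(⊥ : Subgroup (quasiSplit (↥(maximalRealSubfield L)) L (IsCMField.complexConj L) 3).Adelic) →* ℂ) : ↥(⊥ : Subgroup (quasiSplit (↥(maximalRealSubfield L)) L (IsCMField.complexConj L) 3).Adelic) → ℂ) ∧ Continuous p.1 ∧
        ∃ (Ec : ℂ → (quasiSplit (↥(maximalRealSubfield L)) L (IsCMField.complexConj L) 3).Adelic → ℂ) (Sp : Finset ℂ)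
          (_ : ∀ s ∈ Sp, s.im = 0 ∧ 1 < s.re ∧ s.re ≤ 2)
          (_ : ∀ g, DifferentiableOn ℂ (fun z => Ec z g) ({z : ℂ | 1 < z.re} \ (↑Sp : Set ℂ)))
          (_ : ∀ z : ℂ, 2 < z.re → Ec z = eisensteinSeriesU (flatSectionU p.1 z))
          (Fp : (quasiSplit (↥(maximalRealSubfield L)) L (IsCMField.complexConj L) 3).Adelic → ℂ → ℂ)
          (_ : ∀ g, AnalyticAt ℂ (Fp g) ((3 : ℂ) / 2))
          (_ : ∀ g, Fp g =ᶠ[𝓝[≠] ((3 : ℂ) / 2)] fun z => (z - (3 : ℂ) / 2) * Ec z g),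
          (p.2 : (quasiSplit (↥(maximalRealSubfield L)) L (IsCMField.complexConj L) 3).automorphicQuotient → ℂ) =ᵐ[μ] (fun x : (quasiSplit (↥(maximalRealSubfield L)) L (IsCMField.complexConj L) 3).automorphicQuotient => Fp (Quotient.out (x : ((quasiSplit (↥(maximalRealSubfield L)) L (IsCMField.complexConj L) 3).Adelic ⧸ (quasiSplit (↥(maximalRealSubfield L)) L (IsCMField.complexConj L) 3).quotientSubgroup)))⁻¹ ((3 : ℂ) / 2)))) :
    ∀ p ∈ Gr, ∀ q ∈ Gr, p.1 = q.1 → p.2 = q.2 := by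
  rintro ⟨φ, f⟩ hp ⟨φ', f'⟩ hq hpq
  obtain ⟨-, -, Ec, Sp, hSp, hol, hEc, Fp, hF, hFE, hae⟩ := (hGr _).1 hp
  obtain ⟨-, -, Ec', Sp', hSp', hol', hEc', Fp', hF', hFE', hae'⟩ := (hGr _).1 hq
  simp only at hpq hae hae' hEc hEc' ⊢
  subst hpq
  refine Lp.ext (hae.trans (Eventually.of_forall fun x => ?_) |>.trans hae'.symm)
  exact congrFun (midResidueFun_eq_of_clauses L hSp hol hEc hF hFE hSp' hol' hEc' hF' hFE') x

/-- **The vertical-line test** (Mathlib `Submodule.toLinearPMap`'s hypothesis): a pair in `Gr` with zero section has zero class. [cite: MoeglinWaldspurger1995, IV.1.11] -/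
theorem midResidueGraph_snd_eq_zero_of_fst_eq_zero (Gr : Submodule ℂ (((quasiSplit (↥(maximalRealSubfield L)) L (IsCMField.complexConj L) 3).Adelic → ℂ) × (quasiSplit (↥(maximalRealSubfield L)) L (IsCMField.complexConj L) 3).L2 μ))
    (hGr : ∀ p, p ∈ Gr ↔ (p.1 ∈ chiSectionSpacePair (ξ.bcη⁻¹ * ξ.bcψ⁻¹ * μω) ξ.ψ (⊥ : Subgroup (quasiSplit (↥(maximalRealSubfield L)) L (IsCMField.complexConj L) 3).Adelic)
          ((1 : ↥(⊥ : Subgroup (quasiSplit (↥(maximalRealSubfield L)) L (IsCMField.complexConj L) 3).Adelic) →* ℂ) : ↥(⊥ : Subgroup (quasiSplit (↥(maximalRealSubfield L)) L (IsCMField.complexConj L) 3).Adelic) → ℂ) ∧ Continuous p.1 ∧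
        ∃ (Ec : ℂ → (quasiSplit (↥(maximalRealSubfield L)) L (IsCMField.complexConj L) 3).Adelic → ℂ) (Sp : Finset ℂ)
          (_ : ∀ s ∈ Sp, s.im = 0 ∧ 1 < s.re ∧ s.re ≤ 2)
          (_ : ∀ g, DifferentiableOn ℂ (fun z => Ec z g) ({z : ℂ | 1 < z.re} \ (↑Sp : Set ℂ)))
          (_ : ∀ z : ℂ, 2 < z.re → Ec z = eisensteinSeriesU (flatSectionU p.1 z))
          (Fp : (quasiSplit (↥(maximalRealSubfield L)) L (IsCMField.complexConj L) 3).Adelic → ℂ → ℂ)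
          (_ : ∀ g, AnalyticAt ℂ (Fp g) ((3 : ℂ) / 2))
          (_ : ∀ g, Fp g =ᶠ[𝓝[≠] ((3 : ℂ) / 2)] fun z => (z - (3 : ℂ) / 2) * Ec z g),
          (p.2 : (quasiSplit (↥(maximalRealSubfield L)) L (IsCMField.complexConj L) 3).automorphicQuotient → ℂ) =ᵐ[μ] (fun x : (quasiSplit (↥(maximalRealSubfield L)) L (IsCMField.complexConj L) 3).automorphicQuotient => Fp (Quotient.out (x : ((quasiSplit (↥(maximalRealSubfield L)) L (IsCMField.complexConj L) 3).Adelic ⧸ (quasiSplit (↥(maximalRealSubfield L)) L (IsCMField.complexConj L) 3).quotientSubgroup)))⁻¹ ((3 : ℂ) / 2)))) :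
    ∀ (x : ((quasiSplit (↥(maximalRealSubfield L)) L (IsCMField.complexConj L) 3).Adelic → ℂ) × (quasiSplit (↥(maximalRealSubfield L)) L (IsCMField.complexConj L) 3).L2 μ) (_ : x ∈ Gr) (_ : x.fst = 0), x.snd = 0 :=
  fun x hx h0 => (midResidueGraph_snd_eq_of_fst_eq L μ ξ μω Gr hGr x hx 0 Gr.zero_mem (by rw [h0, Prod.fst_zero])).trans Prod.snd_zero

/-- **`Res := Gr.toLinearPMap` IS the residue map on its domain `Gr.map fst`**: `(ψ, Res ψ) ∈ Gr` for every section `ψ` in the domain (Mathlib `Submodule.mem_graph_toLinearPMap`).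
[cite: MoeglinWaldspurger1995, IV.1.11, V.3.13] -/
theorem mem_midResidueGraph_toLinearPMap (Gr : Submodule ℂ (((quasiSplit (↥(maximalRealSubfield L)) L (IsCMField.complexConj L) 3).Adelic → ℂ) × (quasiSplit (↥(maximalRealSubfield L)) L (IsCMField.complexConj L) 3).L2 μ))
    (hGr : ∀ p, p ∈ Gr ↔ (p.1 ∈ chiSectionSpacePair (ξ.bcη⁻¹ * ξ.bcψ⁻¹ * μω) ξ.ψ (⊥ : Subgroup (quasiSplit (↥(maximalRealSubfield L)) L (IsCMField.complexConj L) 3).Adelic)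
          ((1 : ↥(⊥ : Subgroup (quasiSplit (↥(maximalRealSubfield L)) L (IsCMField.complexConj L) 3).Adelic) →* ℂ) : ↥(⊥ : Subgroup (quasiSplit (↥(maximalRealSubfield L)) L (IsCMField.complexConj L) 3).Adelic) → ℂ) ∧ Continuous p.1 ∧
        ∃ (Ec : ℂ → (quasiSplit (↥(maximalRealSubfield L)) L (IsCMField.complexConj L) 3).Adelic → ℂ) (Sp : Finset ℂ)
          (_ : ∀ s ∈ Sp, s.im = 0 ∧ 1 < s.re ∧ s.re ≤ 2)
          (_ : ∀ g, DifferentiableOn ℂ (fun z => Ec z g) ({z : ℂ | 1 < z.re} \ (↑Sp : Set ℂ)))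
          (_ : ∀ z : ℂ, 2 < z.re → Ec z = eisensteinSeriesU (flatSectionU p.1 z))
          (Fp : (quasiSplit (↥(maximalRealSubfield L)) L (IsCMField.complexConj L) 3).Adelic → ℂ → ℂ)
          (_ : ∀ g, AnalyticAt ℂ (Fp g) ((3 : ℂ) / 2))
          (_ : ∀ g, Fp g =ᶠ[𝓝[≠] ((3 : ℂ) / 2)] fun z => (z - (3 : ℂ) / 2) * Ec z g),
          (p.2 : (quasiSplit (↥(maximalRealSubfield L)) L (IsCMField.complexConj L) 3).automorphicQuotient → ℂ) =ᵐ[μ] (fun x : (quasiSplit (↥(maximalRealSubfield L)) L (IsCMField.complexConj L) 3).automorphicQuotient => Fp (Quotient.out (x : ((quasiSplit (↥(maximalRealSubfield L)) L (IsCMField.complexConj L) 3).Adelic ⧸ (quasiSplit (↥(maximalRealSubfield L)) L (IsCMField.complexConj L) 3).quotientSubgroup)))⁻¹ ((3 : ℂ) / 2))))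
    (x : ↥(Gr.map (LinearMap.fst ℂ ((quasiSplit (↥(maximalRealSubfield L)) L (IsCMField.complexConj L) 3).Adelic → ℂ) ((quasiSplit (↥(maximalRealSubfield L)) L (IsCMField.complexConj L) 3).L2 μ)))) :
    ((x : (quasiSplit (↥(maximalRealSubfield L)) L (IsCMField.complexConj L) 3).Adelic → ℂ), Gr.toLinearPMap x) ∈ Gr :=
  Submodule.mem_graph_toLinearPMap (midResidueGraph_snd_eq_zero_of_fst_eq_zero L μ ξ μω Gr hGr) x

/-! ## §3 `K_max`-transport: `(φ, f) ∈ Gr ⇒ (r(k)φ, R(k)f) ∈ Gr`; the domain is stable and `Res` is equivariant -/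

section Transport

variable [(quasiSplit (↥(maximalRealSubfield L)) L (IsCMField.complexConj L) 3).IsAutomorphicMeasure μ]

/-- **`K_max`-TRANSPORT OF THE RESIDUE RELATION** (★ p863205 §3's proof with the section exposed, at level `⊥`): for `k ∈ K_max` (height-preserving ★, commuting with `⊥`) and `(φ, f) ∈ Gr`
with data `(Ec, Sp, Fp)`, the pair `(r(k)φ, R(k)f)` is in `Gr` with data `(Ec(·)(·k), Sp, Fp(·k))` — the residue function is left-`G(F)`-invariant (★ `midPoleLetter_apply_quotientSubgroup_mul`),
so `R(k)[x ↦ Fp((out x)⁻¹)(3/2)] = [x ↦ Fp((out x)⁻¹k)(3/2)]` (★ `quotFun_rightTranslation`, ★ `rightRegular_apply_coeFn`). [cite: MoeglinWaldspurger1995, II.1.5, IV.1.11] [cite: BorelJacquet1979, §4.6] -/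
theorem rightTranslation_mem_midResidueGraph (Gr : Submodule ℂ (((quasiSplit (↥(maximalRealSubfield L)) L (IsCMField.complexConj L) 3).Adelic → ℂ) × (quasiSplit (↥(maximalRealSubfield L)) L (IsCMField.complexConj L) 3).L2 μ))
    (hGr : ∀ p, p ∈ Gr ↔ (p.1 ∈ chiSectionSpacePair (ξ.bcη⁻¹ * ξ.bcψ⁻¹ * μω) ξ.ψ (⊥ : Subgroup (quasiSplit (↥(maximalRealSubfield L)) L (IsCMField.complexConj L) 3).Adelic)
          ((1 : ↥(⊥ : Subgroup (quasiSplit (↥(maximalRealSubfield L)) L (IsCMField.complexConj L) 3).Adelic) →* ℂ) : ↥(⊥ : Subgroup (quasiSplit (↥(maximalRealSubfield L)) L (IsCMField.complexConj L) 3).Adelic) → ℂ) ∧ Continuous p.1 ∧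
        ∃ (Ec : ℂ → (quasiSplit (↥(maximalRealSubfield L)) L (IsCMField.complexConj L) 3).Adelic → ℂ) (Sp : Finset ℂ)
          (_ : ∀ s ∈ Sp, s.im = 0 ∧ 1 < s.re ∧ s.re ≤ 2)
          (_ : ∀ g, DifferentiableOn ℂ (fun z => Ec z g) ({z : ℂ | 1 < z.re} \ (↑Sp : Set ℂ)))
          (_ : ∀ z : ℂ, 2 < z.re → Ec z = eisensteinSeriesU (flatSectionU p.1 z))
          (Fp : (quasiSplit (↥(maximalRealSubfield L)) L (IsCMField.complexConj L) 3).Adelic → ℂ → ℂ)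
          (_ : ∀ g, AnalyticAt ℂ (Fp g) ((3 : ℂ) / 2))
          (_ : ∀ g, Fp g =ᶠ[𝓝[≠] ((3 : ℂ) / 2)] fun z => (z - (3 : ℂ) / 2) * Ec z g),
          (p.2 : (quasiSplit (↥(maximalRealSubfield L)) L (IsCMField.complexConj L) 3).automorphicQuotient → ℂ) =ᵐ[μ] (fun x : (quasiSplit (↥(maximalRealSubfield L)) L (IsCMField.complexConj L) 3).automorphicQuotient => Fp (Quotient.out (x : ((quasiSplit (↥(maximalRealSubfield L)) L (IsCMField.complexConj L) 3).Adelic ⧸ (quasiSplit (↥(maximalRealSubfield L)) L (IsCMField.complexConj L) 3).quotientSubgroup)))⁻¹ ((3 : ℂ) / 2))))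
    {k : (quasiSplit (↥(maximalRealSubfield L)) L (IsCMField.complexConj L) 3).Adelic} (hk : k ∈ ((standardMaximalCompactGL 3 L).comap (adelicVal (↥(maximalRealSubfield L)) L (IsCMField.complexConj L) 3 ((StdForm.antidiagonal 3).over L)) :
      Subgroup (quasiSplit (↥(maximalRealSubfield L)) L (IsCMField.complexConj L) 3).Adelic))
    {p : ((quasiSplit (↥(maximalRealSubfield L)) L (IsCMField.complexConj L) 3).Adelic → ℂ) × (quasiSplit (↥(maximalRealSubfield L)) L (IsCMField.complexConj L) 3).L2 μ} (hp : p ∈ Gr) :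
    (rightTranslation (quasiSplit (↥(maximalRealSubfield L)) L (IsCMField.complexConj L) 3) k p.1, ((quasiSplit (↥(maximalRealSubfield L)) L (IsCMField.complexConj L) 3).rightRegular μ) k p.2) ∈ Gr := by
  obtain ⟨φ, f⟩ := p
  obtain ⟨hφ, hφc, Ec, Sp, hSp, hol, hEc, Fp, hF, hFE, hae⟩ := (hGr _).1 hp
  simp only at hφ hφc hEc hae ⊢
  have hHk : ∀ g : (quasiSplit (↥(maximalRealSubfield L)) L (IsCMField.complexConj L) 3).Adelic, borelHeight (g * k) = borelHeight g := fun g => borelHeight_mul_of_mem_comap_standardMaximalCompactGL hk g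
  have hck : Continuous (rightTranslation (quasiSplit (↥(maximalRealSubfield L)) L (IsCMField.complexConj L) 3) k φ) := by
    have h : rightTranslation (quasiSplit (↥(maximalRealSubfield L)) L (IsCMField.complexConj L) 3) k φ = fun g => φ (g * k) := funext fun g => rfl
    rw [h]
    exact hφc.comp (continuous_id.mul continuous_const)
  have hinv : ∀ γ ∈ (quasiSplit (↥(maximalRealSubfield L)) L (IsCMField.complexConj L) 3).quotientSubgroup, ∀ g : (quasiSplit (↥(maximalRealSubfield L)) L (IsCMField.complexConj L) 3).Adelic,
      (fun g : (quasiSplit (↥(maximalRealSubfield L)) L (IsCMField.complexConj L) 3).Adelic => Fp g ((3 : ℂ) / 2)) (γ * g) = (fun g : (quasiSplit (↥(maximalRealSubfield L)) L (IsCMField.complexConj L) 3).Adelic => Fp g ((3 : ℂ) / 2)) g :=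
    midPoleLetter_apply_quotientSubgroup_mul L (isChiSectionPair_of_mem hφ) ξ.hψ (fun s hs => (hSp s hs).1) hol hEc (by norm_num) (by norm_num) hF hFE
  have h3 := AdelicGroupData.quotFun_rightTranslation (φ := fun g : (quasiSplit (↥(maximalRealSubfield L)) L (IsCMField.complexConj L) 3).Adelic => Fp g ((3 : ℂ) / 2)) hinv k
  refine (hGr _).2 ⟨rightTranslation_mem_chiSectionSpacePair L (fun k' hk' => by rw [Subgroup.mem_bot.1 hk', one_mul, mul_one]) hφ, hck,
    fun z g => Ec z (g * k), Sp, hSp, fun g => hol (g * k), fun z hz => ?_, fun g => Fp (g * k), fun g => hF (g * k), fun g => hFE (g * k), ?_⟩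
  · funext g
    show Ec z (g * k) = eisensteinSeriesU (flatSectionU (rightTranslation (quasiSplit (↥(maximalRealSubfield L)) L (IsCMField.complexConj L) 3) k φ) z) g
    rw [flatSectionU_rightTranslation L hHk, eisensteinSeriesU_rightTranslation, hEc z hz]
  · have h1 := (quasiSplit (↥(maximalRealSubfield L)) L (IsCMField.complexConj L) 3).rightRegular_apply_coeFn μ k f
    have h2 := (measurePreserving_smul k⁻¹ μ).quasiMeasurePreserving.ae_eq_comp hae
    exact h1.trans (h2.trans (Filter.Eventually.of_forall fun x => (congrFun h3 x).symm))

/-- **The domain `Gr.map fst` of the residue map is `K_max`-stable.** [cite: MoeglinWaldspurger1995, II.1.5] -/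
theorem rightTranslation_mem_map_fst_midResidueGraph (Gr : Submodule ℂ (((quasiSplit (↥(maximalRealSubfield L)) L (IsCMField.complexConj L) 3).Adelic → ℂ) × (quasiSplit (↥(maximalRealSubfield L)) L (IsCMField.complexConj L) 3).L2 μ))
    (hGr : ∀ p, p ∈ Gr ↔ (p.1 ∈ chiSectionSpacePair (ξ.bcη⁻¹ * ξ.bcψ⁻¹ * μω) ξ.ψ (⊥ : Subgroup (quasiSplit (↥(maximalRealSubfield L)) L (IsCMField.complexConj L) 3).Adelic)
          ((1 : ↥(⊥ : Subgroup (quasiSplit (↥(maximalRealSubfield L)) L (IsCMField.complexConj L) 3).Adelic) →* ℂ) : ↥(⊥ : Subgroup (quasiSplit (↥(maximalRealSubfield L)) L (IsCMField.complexConj L) 3).Adelic) → ℂ) ∧ Continuous p.1 ∧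
        ∃ (Ec : ℂ → (quasiSplit (↥(maximalRealSubfield L)) L (IsCMField.complexConj L) 3).Adelic → ℂ) (Sp : Finset ℂ)
          (_ : ∀ s ∈ Sp, s.im = 0 ∧ 1 < s.re ∧ s.re ≤ 2)
          (_ : ∀ g, DifferentiableOn ℂ (fun z => Ec z g) ({z : ℂ | 1 < z.re} \ (↑Sp : Set ℂ)))
          (_ : ∀ z : ℂ, 2 < z.re → Ec z = eisensteinSeriesU (flatSectionU p.1 z))
          (Fp : (quasiSplit (↥(maximalRealSubfield L)) L (IsCMField.complexConj L) 3).Adelic → ℂ → ℂ)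
          (_ : ∀ g, AnalyticAt ℂ (Fp g) ((3 : ℂ) / 2))
          (_ : ∀ g, Fp g =ᶠ[𝓝[≠] ((3 : ℂ) / 2)] fun z => (z - (3 : ℂ) / 2) * Ec z g),
          (p.2 : (quasiSplit (↥(maximalRealSubfield L)) L (IsCMField.complexConj L) 3).automorphicQuotient → ℂ) =ᵐ[μ] (fun x : (quasiSplit (↥(maximalRealSubfield L)) L (IsCMField.complexConj L) 3).automorphicQuotient => Fp (Quotient.out (x : ((quasiSplit (↥(maximalRealSubfield L)) L (IsCMField.complexConj L) 3).Adelic ⧸ (quasiSplit (↥(maximalRealSubfield L)) L (IsCMField.complexConj L) 3).quotientSubgroup)))⁻¹ ((3 : ℂ) / 2))))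
    {k : (quasiSplit (↥(maximalRealSubfield L)) L (IsCMField.complexConj L) 3).Adelic} (hk : k ∈ ((standardMaximalCompactGL 3 L).comap (adelicVal (↥(maximalRealSubfield L)) L (IsCMField.complexConj L) 3 ((StdForm.antidiagonal 3).over L)) :
      Subgroup (quasiSplit (↥(maximalRealSubfield L)) L (IsCMField.complexConj L) 3).Adelic))
    {ψ : (quasiSplit (↥(maximalRealSubfield L)) L (IsCMField.complexConj L) 3).Adelic → ℂ} (hψ : ψ ∈ Gr.map (LinearMap.fst ℂ ((quasiSplit (↥(maximalRealSubfield L)) L (IsCMField.complexConj L) 3).Adelic → ℂ) ((quasiSplit (↥(maximalRealSubfield L)) L (IsCMField.complexConj L) 3).L2 μ))) :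
    rightTranslation (quasiSplit (↥(maximalRealSubfield L)) L (IsCMField.complexConj L) 3) k ψ ∈ Gr.map (LinearMap.fst ℂ ((quasiSplit (↥(maximalRealSubfield L)) L (IsCMField.complexConj L) 3).Adelic → ℂ) ((quasiSplit (↥(maximalRealSubfield L)) L (IsCMField.complexConj L) 3).L2 μ)) := by
  obtain ⟨p, hp, rfl⟩ := hψ
  exact ⟨_, rightTranslation_mem_midResidueGraph L μ ξ μω Gr hGr hk hp, rfl⟩

/-- **`Res` IS `K_max`-EQUIVARIANT**: `Res (r(k)ψ) = R(k) (Res ψ)` on the domain — both `(r(k)ψ, Res (r(k)ψ))` (§2) and `(r(k)ψ, R(k)(Res ψ))` (transport of `(ψ, Res ψ)`) lie in `Gr`, and the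
first projection is injective (§2). [cite: MoeglinWaldspurger1995, II.1.5, V.3.13] -/
theorem toLinearPMap_rightTranslation (Gr : Submodule ℂ (((quasiSplit (↥(maximalRealSubfield L)) L (IsCMField.complexConj L) 3).Adelic → ℂ) × (quasiSplit (↥(maximalRealSubfield L)) L (IsCMField.complexConj L) 3).L2 μ))
    (hGr : ∀ p, p ∈ Gr ↔ (p.1 ∈ chiSectionSpacePair (ξ.bcη⁻¹ * ξ.bcψ⁻¹ * μω) ξ.ψ (⊥ : Subgroup (quasiSplit (↥(maximalRealSubfield L)) L (IsCMField.complexConj L) 3).Adelic)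
          ((1 : ↥(⊥ : Subgroup (quasiSplit (↥(maximalRealSubfield L)) L (IsCMField.complexConj L) 3).Adelic) →* ℂ) : ↥(⊥ : Subgroup (quasiSplit (↥(maximalRealSubfield L)) L (IsCMField.complexConj L) 3).Adelic) → ℂ) ∧ Continuous p.1 ∧
        ∃ (Ec : ℂ → (quasiSplit (↥(maximalRealSubfield L)) L (IsCMField.complexConj L) 3).Adelic → ℂ) (Sp : Finset ℂ)
          (_ : ∀ s ∈ Sp, s.im = 0 ∧ 1 < s.re ∧ s.re ≤ 2)
          (_ : ∀ g, DifferentiableOn ℂ (fun z => Ec z g) ({z : ℂ | 1 < z.re} \ (↑Sp : Set ℂ)))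
          (_ : ∀ z : ℂ, 2 < z.re → Ec z = eisensteinSeriesU (flatSectionU p.1 z))
          (Fp : (quasiSplit (↥(maximalRealSubfield L)) L (IsCMField.complexConj L) 3).Adelic → ℂ → ℂ)
          (_ : ∀ g, AnalyticAt ℂ (Fp g) ((3 : ℂ) / 2))
          (_ : ∀ g, Fp g =ᶠ[𝓝[≠] ((3 : ℂ) / 2)] fun z => (z - (3 : ℂ) / 2) * Ec z g),
          (p.2 : (quasiSplit (↥(maximalRealSubfield L)) L (IsCMField.complexConj L) 3).automorphicQuotient → ℂ) =ᵐ[μ] (fun x : (quasiSplit (↥(maximalRealSubfield L)) L (IsCMField.complexConj L) 3).automorphicQuotient => Fp (Quotient.out (x : ((quasiSplit (↥(maximalRealSubfield L)) L (IsCMField.complexConj L) 3).Adelic ⧸ (quasiSplit (↥(maximalRealSubfield L)) L (IsCMField.complexConj L) 3).quotientSubgroup)))⁻¹ ((3 : ℂ) / 2))))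
    {k : (quasiSplit (↥(maximalRealSubfield L)) L (IsCMField.complexConj L) 3).Adelic} (hk : k ∈ ((standardMaximalCompactGL 3 L).comap (adelicVal (↥(maximalRealSubfield L)) L (IsCMField.complexConj L) 3 ((StdForm.antidiagonal 3).over L)) :
      Subgroup (quasiSplit (↥(maximalRealSubfield L)) L (IsCMField.complexConj L) 3).Adelic))
    (x : ↥(Gr.map (LinearMap.fst ℂ ((quasiSplit (↥(maximalRealSubfield L)) L (IsCMField.complexConj L) 3).Adelic → ℂ) ((quasiSplit (↥(maximalRealSubfield L)) L (IsCMField.complexConj L) 3).L2 μ)))) :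
    Gr.toLinearPMap ⟨rightTranslation (quasiSplit (↥(maximalRealSubfield L)) L (IsCMField.complexConj L) 3) k (x : (quasiSplit (↥(maximalRealSubfield L)) L (IsCMField.complexConj L) 3).Adelic → ℂ), rightTranslation_mem_map_fst_midResidueGraph L μ ξ μω Gr hGr hk x.2⟩ =
      ((quasiSplit (↥(maximalRealSubfield L)) L (IsCMField.complexConj L) 3).rightRegular μ) k (Gr.toLinearPMap x) :=
  midResidueGraph_snd_eq_of_fst_eq L μ ξ μω Gr hGr _ (mem_midResidueGraph_toLinearPMap L μ ξ μω Gr hGr _) _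
    (rightTranslation_mem_midResidueGraph L μ ξ μω Gr hGr hk (mem_midResidueGraph_toLinearPMap L μ ξ μω Gr hGr x)) rfl

end Transport

/-! ## §4 The generators of the level-free atom are the second projection of `Gr` -/

/-- **`f ∈ resGMidAtomGen ξ μω ⊥ 1 ↔ ∃ φ, (φ, f) ∈ Gr`** — ★ D1 at level `(⊥, 1)` with the section exposed (pure rearrangement of the `∃`). [cite: Rogawski1990, §13.9 p. 229 (ii)] -/
theorem mem_resGMidAtomGen_bot_iff_exists_mem_midResidueGraph (Gr : Submodule ℂ (((quasiSplit (↥(maximalRealSubfield L)) L (IsCMField.complexConj L) 3).Adelic → ℂ) × (quasiSplit (↥(maximalRealSubfield L)) L (IsCMField.complexConj L) 3).L2 μ))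
    (hGr : ∀ p, p ∈ Gr ↔ (p.1 ∈ chiSectionSpacePair (ξ.bcη⁻¹ * ξ.bcψ⁻¹ * μω) ξ.ψ (⊥ : Subgroup (quasiSplit (↥(maximalRealSubfield L)) L (IsCMField.complexConj L) 3).Adelic)
          ((1 : ↥(⊥ : Subgroup (quasiSplit (↥(maximalRealSubfield L)) L (IsCMField.complexConj L) 3).Adelic) →* ℂ) : ↥(⊥ : Subgroup (quasiSplit (↥(maximalRealSubfield L)) L (IsCMField.complexConj L) 3).Adelic) → ℂ) ∧ Continuous p.1 ∧
        ∃ (Ec : ℂ → (quasiSplit (↥(maximalRealSubfield L)) L (IsCMField.complexConj L) 3).Adelic → ℂ) (Sp : Finset ℂ)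
          (_ : ∀ s ∈ Sp, s.im = 0 ∧ 1 < s.re ∧ s.re ≤ 2)
          (_ : ∀ g, DifferentiableOn ℂ (fun z => Ec z g) ({z : ℂ | 1 < z.re} \ (↑Sp : Set ℂ)))
          (_ : ∀ z : ℂ, 2 < z.re → Ec z = eisensteinSeriesU (flatSectionU p.1 z))
          (Fp : (quasiSplit (↥(maximalRealSubfield L)) L (IsCMField.complexConj L) 3).Adelic → ℂ → ℂ)
          (_ : ∀ g, AnalyticAt ℂ (Fp g) ((3 : ℂ) / 2))
          (_ : ∀ g, Fp g =ᶠ[𝓝[≠] ((3 : ℂ) / 2)] fun z => (z - (3 : ℂ) / 2) * Ec z g),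
          (p.2 : (quasiSplit (↥(maximalRealSubfield L)) L (IsCMField.complexConj L) 3).automorphicQuotient → ℂ) =ᵐ[μ] (fun x : (quasiSplit (↥(maximalRealSubfield L)) L (IsCMField.complexConj L) 3).automorphicQuotient => Fp (Quotient.out (x : ((quasiSplit (↥(maximalRealSubfield L)) L (IsCMField.complexConj L) 3).Adelic ⧸ (quasiSplit (↥(maximalRealSubfield L)) L (IsCMField.complexConj L) 3).quotientSubgroup)))⁻¹ ((3 : ℂ) / 2))))
    (f : (quasiSplit (↥(maximalRealSubfield L)) L (IsCMField.complexConj L) 3).L2 μ) :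
    f ∈ resGMidAtomGen L μ ξ μω ⊥ 1 ↔ ∃ φ : (quasiSplit (↥(maximalRealSubfield L)) L (IsCMField.complexConj L) 3).Adelic → ℂ, (φ, f) ∈ Gr := by
  constructor
  · rintro ⟨φ, hφ, hc, Ec, Sp, hSp, hol, hEc, Fp, hF, hFE, hae⟩
    exact ⟨φ, (hGr _).2 ⟨hφ, hc, Ec, Sp, hSp, hol, hEc, Fp, hF, hFE, hae⟩⟩
  · rintro ⟨φ, hp⟩
    obtain ⟨hφ, hc, Ec, Sp, hSp, hol, hEc, Fp, hF, hFE, hae⟩ := (hGr _).1 hp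
    exact ⟨φ, hφ, hc, Ec, Sp, hSp, hol, hEc, Fp, hF, hFE, hae⟩

/-- **The generators lie in the second projection `Gr.map snd`** (so `resGMidAtom ξ μω ⊥ 1 ≤ closure (Gr.map snd)`). [cite: Rogawski1990, §13.9 p. 229 (ii)] [cite: MoeglinWaldspurger1995, V.3.13] -/
theorem resGMidAtomGen_bot_subset_map_snd (Gr : Submodule ℂ (((quasiSplit (↥(maximalRealSubfield L)) L (IsCMField.complexConj L) 3).Adelic → ℂ) × (quasiSplit (↥(maximalRealSubfield L)) L (IsCMField.complexConj L) 3).L2 μ))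
    (hGr : ∀ p, p ∈ Gr ↔ (p.1 ∈ chiSectionSpacePair (ξ.bcη⁻¹ * ξ.bcψ⁻¹ * μω) ξ.ψ (⊥ : Subgroup (quasiSplit (↥(maximalRealSubfield L)) L (IsCMField.complexConj L) 3).Adelic)
          ((1 : ↥(⊥ : Subgroup (quasiSplit (↥(maximalRealSubfield L)) L (IsCMField.complexConj L) 3).Adelic) →* ℂ) : ↥(⊥ : Subgroup (quasiSplit (↥(maximalRealSubfield L)) L (IsCMField.complexConj L) 3).Adelic) → ℂ) ∧ Continuous p.1 ∧
        ∃ (Ec : ℂ → (quasiSplit (↥(maximalRealSubfield L)) L (IsCMField.complexConj L) 3).Adelic → ℂ) (Sp : Finset ℂ)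
          (_ : ∀ s ∈ Sp, s.im = 0 ∧ 1 < s.re ∧ s.re ≤ 2)
          (_ : ∀ g, DifferentiableOn ℂ (fun z => Ec z g) ({z : ℂ | 1 < z.re} \ (↑Sp : Set ℂ)))
          (_ : ∀ z : ℂ, 2 < z.re → Ec z = eisensteinSeriesU (flatSectionU p.1 z))
          (Fp : (quasiSplit (↥(maximalRealSubfield L)) L (IsCMField.complexConj L) 3).Adelic → ℂ → ℂ)
          (_ : ∀ g, AnalyticAt ℂ (Fp g) ((3 : ℂ) / 2))
          (_ : ∀ g, Fp g =ᶠ[𝓝[≠] ((3 : ℂ) / 2)] fun z => (z - (3 : ℂ) / 2) * Ec z g),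
          (p.2 : (quasiSplit (↥(maximalRealSubfield L)) L (IsCMField.complexConj L) 3).automorphicQuotient → ℂ) =ᵐ[μ] (fun x : (quasiSplit (↥(maximalRealSubfield L)) L (IsCMField.complexConj L) 3).automorphicQuotient => Fp (Quotient.out (x : ((quasiSplit (↥(maximalRealSubfield L)) L (IsCMField.complexConj L) 3).Adelic ⧸ (quasiSplit (↥(maximalRealSubfield L)) L (IsCMField.complexConj L) 3).quotientSubgroup)))⁻¹ ((3 : ℂ) / 2)))) :
    resGMidAtomGen L μ ξ μω ⊥ 1 ⊆ (Gr.map (LinearMap.snd ℂ ((quasiSplit (↥(maximalRealSubfield L)) L (IsCMField.complexConj L) 3).Adelic → ℂ) ((quasiSplit (↥(maximalRealSubfield L)) L (IsCMField.complexConj L) 3).L2 μ)) : Set ((quasiSplit (↥(maximalRealSubfield L)) L (IsCMField.complexConj L) 3).L2 μ)) := fun f hf => by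
  obtain ⟨φ, hp⟩ := (mem_resGMidAtomGen_bot_iff_exists_mem_midResidueGraph L μ ξ μω Gr hGr f).1 hf
  exact ⟨(φ, f), hp, rfl⟩

end Summit.HodgeConjecture.HodgeConjecture.R90.S8

end
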